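import Mathlib.GroupTheory.OrderOfElement
import Summits.MatrixMultiplication.OmegaCensus.DihedralLawModOneShapeBLemmas
import Summits.MatrixMultiplication.OmegaCensus.DihedralLikeVertexCounting
import HarnessLib

/-!
# A near-factorization with a domino forces cyclicity; cube law shapes with an aligned pair of 2-parts

ω-census, family (b3).  Framing: lottery ticket; floor = certified bounds/negative ranges.

**Domino lemma (`coset_eq_univ_of_domino_near_tiling`).** If `Z ⊔ (Z + t) = A ∖ {x₀}` in a finite abelian group
(`Z ∩ (Z+t) = ∅`, `|A| = 2|Z| + 1`), then `A = x₀ + ⟨t⟩`: every coset of `⟨t⟩` avoiding `x₀` would be tiled by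
dominoes `{z, z+t}` hence of even size, while the coset of `x₀` has odd size — so there is only one coset.  (This is
the `|B| = 2` case of "an abelian group with a near-factorization `A ∖ {0} = B + C`, `|B| ≤ 4`, is cyclic",
de Caen–Gregory–Hughes–Kreher 1990.)

**Application (`cyclic_of_law_cube_aligned_pair`).** Dihedral-like `G` over `A` (`ρ a ρ b = ρ(a+b)`, …, any `c₀`).
Let `(S,T,U)` be a TPP triple whose `T`-parts are `T₀ = {b₁, b₁ + t}`, `T₁ = {b₃, b₃ + t}` (two 2-element parts
with the SAME difference up to sign — write `{b, b−t}` as `{b−t, (b−t)+t}`) and whose vertex `000` is a near-tiling,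
`2(s₁u₀ + s₀u₀ + s₀u₁) + 1 = |A|` — e.g. any law-attaining triple at `|A| ≡ 1 (mod 3)` with cube part sizes
`(c,c | 2,2 | e,e)` (`cyclic_of_law_cube_aligned_pair'`).  Then `A = x₀ + ⟨t⟩` is CYCLIC, generated by `t`:
the three boxes `S₁+T₀+U₀, S₀+T₁+U₀, S₀+T₀+U₁` are `Z ⊔ (Z+t)` for `Z = (S₁+U₀+b₁) ∪ (S₀+U₀+b₃) ∪ (S₀+U₁+b₁)`.
Census context: in every law-attaining cube triple found by enumeration (`D₅₀`, shape `(1,1|2,2|4,4)`, 1760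
triples; kit jobs j109688/j109292) the 2-element parts ARE aligned (`t' = ±t`); that alignment is the remaining
conjectural step for "cube with a part pair of size 2 ⇒ `A` cyclic".
-/

namespace Summit.MatrixMultiplication.OmegaCensus

open Literature.Combinatorics.Additive Finset

section Domino

variable {A : Type*} [AddCommGroup A] [Fintype A] [DecidableEq A]

/-- The coset `x + ⟨t⟩` as a `Finset` has `ord(t)` elements. [folklore] -/
theorem card_filter_sub_mem_zmultiples (t x : A) :
    (univ.filter fun y : A => y - x ∈ AddSubgroup.zmultiples t).card = addOrderOf t := by
  classical
  set D := AddSubgroup.zmultiples t with hD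
  have hcardD : (univ.filter fun y : A => y ∈ D).card = addOrderOf t := by
    rw [← Nat.card_zmultiples t, ← hD, Nat.card_eq_fintype_card, ← Fintype.card_coe]
    refine Fintype.card_congr (Equiv.subtypeEquiv (Equiv.refl A) fun x => ?_)
    simp
  have hK : (univ.filter fun y => y ∈ D).image (fun y => y + x) = univ.filter fun y => y - x ∈ D := by
    ext y
    simp only [mem_image, mem_filter, mem_univ, true_and]
    constructor
    · rintro ⟨z, hz, rfl⟩; simpa using hz
    · intro hy; exact ⟨y - x, hy, sub_add_cancel y x⟩
  rw [← hcardD, ← hK, card_image_of_injective _ (add_left_injective x)]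

/-- **Domino near-factorization ⇒ one coset.** If `Z` and `Z + t` are disjoint and `|A| = 2|Z| + 1`, then the
point `x₀` they miss satisfies `A = x₀ + ⟨t⟩` (so `A` is cyclic, generated by `t`). [folklore] -/
theorem coset_eq_univ_of_domino_near_tiling {Z : Finset A} {t : A} (hZ : Disjoint Z (Z.image (· + t)))
    (hcard : Fintype.card A = 2 * Z.card + 1) :
    ∃ x₀ : A, ∀ y : A, y - x₀ ∈ AddSubgroup.zmultiples t := by
  classical
  set D := AddSubgroup.zmultiples t with hD
  -- the missed point
  have hR : (univ \ (Z ∪ Z.image (· + t))).card = 1 := by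
    rw [card_univ_sdiff, card_union_of_disjoint hZ, card_image_add]; omega
  obtain ⟨x₀, hx₀⟩ := card_eq_one.1 hR
  have hx₀' : x₀ ∉ Z ∪ Z.image (· + t) := by
    have : x₀ ∈ univ \ (Z ∪ Z.image (· + t)) := by rw [hx₀]; exact mem_singleton_self _
    exact (mem_sdiff.1 this).2
  have hcov : ∀ y : A, y ≠ x₀ → y ∈ Z ∪ Z.image (· + t) := by
    intro y hy
    by_contra hc
    have : y ∈ univ \ (Z ∪ Z.image (· + t)) := mem_sdiff.2 ⟨mem_univ _, hc⟩
    rw [hx₀, mem_singleton] at this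
    exact hy this
  refine ⟨x₀, fun y => ?_⟩
  by_contra hy
  -- the coset `K` of `y` avoids `x₀` and is tiled by dominoes: even size
  set K := univ.filter fun z : A => z - y ∈ D with hK
  have hKZ : (K ∩ Z).image (· + t) = K ∩ Z.image (· + t) := by
    ext w
    simp only [mem_image, mem_inter, hK, mem_filter, mem_univ, true_and]
    constructor
    · rintro ⟨z, ⟨hzD, hzZ⟩, rfl⟩
      refine ⟨?_, z, hzZ, rfl⟩
      have e : z + t - y = (z - y) + t := by abel
      rw [e]; exact D.add_mem hzD (AddSubgroup.mem_zmultiples t)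
    · rintro ⟨hwD, z, hzZ, rfl⟩
      refine ⟨z, ⟨?_, hzZ⟩, rfl⟩
      have e : z - y = (z + t - y) - t := by abel
      rw [e]; exact D.sub_mem hwD (AddSubgroup.mem_zmultiples t)
  have hx₀K : x₀ ∉ K := by
    intro h
    rw [hK, mem_filter] at h
    exact hy (by have := D.neg_mem h.2; rwa [neg_sub] at this)
  have hKsplit : K = (K ∩ Z) ∪ (K ∩ Z.image (· + t)) := by
    ext w
    simp only [mem_union, mem_inter]
    constructor
    · intro hw
      have hw' : w ≠ x₀ := fun h => hx₀K (h ▸ hw)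
      rcases mem_union.1 (hcov w hw') with h | h
      · exact Or.inl ⟨hw, h⟩
      · exact Or.inr ⟨hw, h⟩
    · rintro (⟨hw, -⟩ | ⟨hw, -⟩) <;> exact hw
  have hKc : K.card = (K ∩ Z).card + (K ∩ Z.image (· + t)).card := by
    conv_lhs => rw [hKsplit]
    exact card_union_of_disjoint (disjoint_of_subset_left inter_subset_right
      (disjoint_of_subset_right inter_subset_right hZ))
  have hKc2 : (K ∩ Z.image (· + t)).card = (K ∩ Z).card := by
    rw [← hKZ, card_image_of_injective _ (add_left_injective t)]
  have hKeven : K.card = 2 * (K ∩ Z).card := by omega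
  -- the coset of `x₀`: odd size
  set K₀ := univ.filter fun z : A => z - x₀ ∈ D with hK₀
  have hK₀Z : (K₀ ∩ Z).image (· + t) = K₀ ∩ Z.image (· + t) := by
    ext w
    simp only [mem_image, mem_inter, hK₀, mem_filter, mem_univ, true_and]
    constructor
    · rintro ⟨z, ⟨hzD, hzZ⟩, rfl⟩
      refine ⟨?_, z, hzZ, rfl⟩
      have e : z + t - x₀ = (z - x₀) + t := by abel
      rw [e]; exact D.add_mem hzD (AddSubgroup.mem_zmultiples t)
    · rintro ⟨hwD, z, hzZ, rfl⟩
      refine ⟨z, ⟨?_, hzZ⟩, rfl⟩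
      have e : z - x₀ = (z + t - x₀) - t := by abel
      rw [e]; exact D.sub_mem hwD (AddSubgroup.mem_zmultiples t)
  have hx₀K₀ : x₀ ∈ K₀ := by rw [hK₀, mem_filter]; exact ⟨mem_univ _, by rw [sub_self]; exact D.zero_mem⟩
  have hK₀split : K₀ = (K₀ ∩ Z) ∪ (K₀ ∩ Z.image (· + t)) ∪ {x₀} := by
    ext w
    simp only [mem_union, mem_inter, mem_singleton]
    constructor
    · intro hw
      by_cases hw' : w = x₀
      · exact Or.inr hw'
      · rcases mem_union.1 (hcov w hw') with h | h
        · exact Or.inl (Or.inl ⟨hw, h⟩)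
        · exact Or.inl (Or.inr ⟨hw, h⟩)
    · rintro ((⟨hw, -⟩ | ⟨hw, -⟩) | rfl)
      · exact hw
      · exact hw
      · exact hx₀K₀
  have hK₀odd : K₀.card = 2 * (K₀ ∩ Z).card + 1 := by
    have hd1 : Disjoint (K₀ ∩ Z) (K₀ ∩ Z.image (· + t)) :=
      disjoint_of_subset_left inter_subset_right (disjoint_of_subset_right inter_subset_right hZ)
    have hd2 : Disjoint (K₀ ∩ Z ∪ K₀ ∩ Z.image (· + t)) {x₀} := by
      rw [disjoint_singleton_right]
      intro h
      rcases mem_union.1 h with h | h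
      · exact hx₀' (mem_union_left _ (mem_inter.1 h).2)
      · exact hx₀' (mem_union_right _ (mem_inter.1 h).2)
    have hc : K₀.card = (K₀ ∩ Z).card + (K₀ ∩ Z.image (· + t)).card + 1 := by
      conv_lhs => rw [hK₀split]
      rw [card_union_of_disjoint hd2, card_union_of_disjoint hd1, card_singleton]
    have hc2 : (K₀ ∩ Z.image (· + t)).card = (K₀ ∩ Z).card := by
      rw [← hK₀Z, card_image_of_injective _ (add_left_injective t)]
    omega
  -- both cosets have `ord(t)` elements
  have c1 : K.card = addOrderOf t := card_filter_sub_mem_zmultiples t y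
  have c2 : K₀.card = addOrderOf t := card_filter_sub_mem_zmultiples t x₀
  omega

end Domino

section DihedralLike

variable {A : Type*} [AddCommGroup A] [DecidableEq A] [Fintype A] {G : Type} [Group G] [DecidableEq G]
  {ρ τ : A → G} {c₀ : A} {S T U : Finset G}

omit [Fintype A] in
/-- A triple sumset whose middle factor is a domino `{p, p+t}`: `X + {p,p+t} + W = Y ⊔ (Y + t)` with
`Y = (X + W) + p`. [folklore] -/
theorem sumset_domino_mid (X W : Finset A) (p t : A) :
    ((X ×ˢ ({p, p + t} : Finset A) ×ˢ W).image fun w : A × A × A => w.1 + w.2.1 + w.2.2) =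
      ((X ×ˢ W).image fun q : A × A => q.1 + q.2 + p) ∪
        (((X ×ˢ W).image fun q : A × A => q.1 + q.2 + p).image (· + t)) := by
  ext x
  rw [mem_sumset₃, mem_union, mem_image, mem_image]
  constructor
  · rintro ⟨a, ha, b, hb, c, hc, rfl⟩
    rcases mem_insert.1 hb with rfl | hb
    · exact Or.inl ⟨(a, c), mem_product.2 ⟨ha, hc⟩, by simp only; abel⟩
    · rw [mem_singleton] at hb; subst hb
      refine Or.inr ⟨a + c + p, mem_image.2 ⟨(a, c), mem_product.2 ⟨ha, hc⟩, rfl⟩, by abel⟩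
  · rintro (⟨q, hq, rfl⟩ | ⟨y, hy, rfl⟩)
    · obtain ⟨ha, hc⟩ := mem_product.1 hq
      exact ⟨q.1, ha, p, mem_insert_self _ _, q.2, hc, by abel⟩
    · obtain ⟨q, hq, rfl⟩ := mem_image.1 hy
      obtain ⟨ha, hc⟩ := mem_product.1 hq
      exact ⟨q.1, ha, p + t, mem_insert_of_mem (mem_singleton_self _), q.2, hc, by abel⟩

/-- **Aligned pair of 2-parts + near-tiling at vertex `000` ⇒ `A` cyclic.**  If the `T`-parts of a TPP triple
of a dihedral-like group are `{b₁, b₁+t}` and `{b₃, b₃+t}` (`t ≠ 0`) and `2(s₁u₀ + s₀u₀ + s₀u₁) + 1 = |A|`, then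
`A = x₀ + ⟨t⟩` for some `x₀`. [folklore] -/
theorem cyclic_of_aligned_pair_near_tiling
    (hρρ : ∀ a b, ρ a * ρ b = ρ (a + b)) (hρτ : ∀ a b, ρ a * τ b = τ (b - a))
    (hτρ : ∀ a b, τ a * ρ b = τ (a + b)) (hττ : ∀ a b, τ a * τ b = ρ (c₀ + b - a))
    (hρ : Function.Injective ρ) (hτ : Function.Injective τ) (hne : ∀ a b, ρ a ≠ τ b)
    (h : TripleProductProperty S T U) {b₁ b₃ t : A} (ht : t ≠ 0)
    (hT₀ : (univ.filter fun a : A => ρ a ∈ T) = {b₁, b₁ + t})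
    (hT₁ : (univ.filter fun a : A => τ a ∈ T) = {b₃, b₃ + t})
    (h000 : 2 * ((univ.filter fun a : A => τ a ∈ S).card * (univ.filter fun a : A => ρ a ∈ U).card +
        (univ.filter fun a : A => ρ a ∈ S).card * (univ.filter fun a : A => ρ a ∈ U).card +
        (univ.filter fun a : A => ρ a ∈ S).card * (univ.filter fun a : A => τ a ∈ U).card) + 1 =
      Fintype.card A) :
    ∃ x₀ : A, ∀ y : A, y - x₀ ∈ AddSubgroup.zmultiples t := by
  set S₀ := univ.filter fun a : A => ρ a ∈ S with hS₀
  set S₁ := univ.filter fun a : A => τ a ∈ S with hS₁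
  set U₀ := univ.filter fun a : A => ρ a ∈ U with hU₀
  set U₁ := univ.filter fun a : A => τ a ∈ U with hU₁
  have hbt : b₁ ≠ b₁ + t := fun e => ht (by
    have := e; rw [eq_comm, ← sub_eq_zero] at this; simpa using this)
  have hbt' : b₃ ≠ b₃ + t := fun e => ht (by
    have := e; rw [eq_comm, ← sub_eq_zero] at this; simpa using this)
  have mS₀ : ∀ a ∈ S₀, cond false (τ a) (ρ a) ∈ S := fun a ha => (mem_filter.1 ha).2
  have mS₁ : ∀ a ∈ S₁, cond true (τ a) (ρ a) ∈ S := fun a ha => (mem_filter.1 ha).2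
  have mS₀' : ∀ a ∈ S₀, ρ a ∈ S := mS₀
  have mS₁' : ∀ a ∈ S₁, τ a ∈ S := mS₁
  have mT₀ : ∀ b ∈ ({b₁, b₁ + t} : Finset A), ρ b ∈ T := fun b hb => by
    have hb' : b ∈ univ.filter fun a : A => ρ a ∈ T := by rw [hT₀]; exact hb
    exact (mem_filter.1 hb').2
  have mT₁ : ∀ b ∈ ({b₃, b₃ + t} : Finset A), τ b ∈ T := fun b hb => by
    have hb' : b ∈ univ.filter fun a : A => τ a ∈ T := by rw [hT₁]; exact hb
    exact (mem_filter.1 hb').2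
  have mT₀c : ∀ b ∈ ({b₁, b₁ + t} : Finset A), cond false (τ b) (ρ b) ∈ T := mT₀
  have mT₁c : ∀ b ∈ ({b₃, b₃ + t} : Finset A), cond true (τ b) (ρ b) ∈ T := mT₁
  have mU₀ : ∀ c ∈ U₀, cond false (τ c) (ρ c) ∈ U := fun c hc => (mem_filter.1 hc).2
  have mU₁ : ∀ c ∈ U₁, cond true (τ c) (ρ c) ∈ U := fun c hc => (mem_filter.1 hc).2
  have mU₀' : ∀ c ∈ U₀, ρ c ∈ U := mU₀
  have mU₁' : ∀ c ∈ U₁, τ c ∈ U := mU₁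
  have cs := card_sumset' hρρ hττ hρ hτ h
  have d₁ := disjoint_sumset₁' hρρ hρτ hτρ hττ hne h
  have d₂ := disjoint_sumset₂' hρρ hρτ hτρ hττ hne h
  have d₃ := disjoint_sumset₃' hρρ hρτ hτρ hττ hne h
  -- the three boxes of vertex `000`
  have c100 := cs true false false mS₁ mT₀c mU₀
  have c010 := cs false true false mS₀ mT₁c mU₀
  have c001 := cs false false true mS₀ mT₀c mU₁
  have D12 := d₁ false mS₁' mT₀ mU₀ mS₀' mT₁          -- B₁₀₀ ∩ B₀₁₀ = ∅
  have D23 := d₂ false mS₀ mT₁ mU₀' mS₀ mT₀ mU₁'      -- B₀₁₀ ∩ B₀₀₁ = ∅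
  have D31 := d₃ false mS₀' mT₀c mU₁' mS₁' mU₀'       -- B₀₀₁ ∩ B₁₀₀ = ∅
  rw [card_pair hbt] at c100 c001
  rw [card_pair hbt'] at c010
  simp only [sumset_domino_mid] at c100 c010 c001 D12 D23 D31
  set Y₁ := (S₁ ×ˢ U₀).image fun q : A × A => q.1 + q.2 + b₁ with hY₁
  set Y₂ := (S₀ ×ˢ U₀).image fun q : A × A => q.1 + q.2 + b₃ with hY₂
  set Y₃ := (S₀ ×ˢ U₁).image fun q : A × A => q.1 + q.2 + b₁ with hY₃
  set Z := Y₁ ∪ Y₂ ∪ Y₃ with hZ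
  have hZt : Z.image (· + t) = Y₁.image (· + t) ∪ Y₂.image (· + t) ∪ Y₃.image (· + t) := by
    rw [hZ, image_union, image_union]
  -- the union of the three boxes has `|A| - 1` elements and is `Z ∪ (Z + t)`
  have hunion : (Y₁ ∪ Y₁.image (· + t)) ∪ (Y₂ ∪ Y₂.image (· + t)) ∪ (Y₃ ∪ Y₃.image (· + t)) =
      Z ∪ Z.image (· + t) := by
    rw [hZt, hZ]
    ext x; simp only [mem_union]; tauto
  have hcardU : ((Y₁ ∪ Y₁.image (· + t)) ∪ (Y₂ ∪ Y₂.image (· + t)) ∪ (Y₃ ∪ Y₃.image (· + t))).card + 1 =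
      Fintype.card A := by
    rw [card_union_of_disjoint (disjoint_union_left.2 ⟨D31.symm, D23⟩), card_union_of_disjoint D12, c100, c010,
      c001, ← h000]
    ring
  have cY₁ : Y₁.card ≤ S₁.card * U₀.card := by
    rw [hY₁, ← card_product]; exact card_image_le
  have cY₂ : Y₂.card ≤ S₀.card * U₀.card := by
    rw [hY₂, ← card_product]; exact card_image_le
  have cY₃ : Y₃.card ≤ S₀.card * U₁.card := by
    rw [hY₃, ← card_product]; exact card_image_le
  have cZle : Z.card ≤ Y₁.card + Y₂.card + Y₃.card :=
    (card_union_le _ _).trans (by have := card_union_le Y₁ Y₂; omega)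
  have cZZ : (Z ∪ Z.image (· + t)).card ≤ Z.card + Z.card := by
    have h1 := card_union_le Z (Z.image (· + t)); rw [card_image_add] at h1; exact h1
  rw [hunion] at hcardU
  have hZcard : Fintype.card A = 2 * Z.card + 1 := by
    have h1 : S₁.card * U₀.card + S₀.card * U₀.card + S₀.card * U₁.card ≤ Z.card := by
      have := h000; omega
    omega
  have hZdisj : Disjoint Z (Z.image (· + t)) :=
    card_union_eq_card_add_card.1 (by rw [card_image_add]; omega)
  exact coset_eq_univ_of_domino_near_tiling hZdisj hZcard

/-- **Cube law shape with an aligned pair of 2-parts ⇒ `A` cyclic.**  A TPP triple with part sizes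
`(c, c | 2, 2 | e, e)`, `T`-parts `{b₁, b₁+t}`, `{b₃, b₃+t}`, attaining `3|S||T||U| + 8 = 8|A|`, forces
`A = x₀ + ⟨t⟩`. [folklore] -/
theorem cyclic_of_law_cube_aligned_pair
    (hρρ : ∀ a b, ρ a * ρ b = ρ (a + b)) (hρτ : ∀ a b, ρ a * τ b = τ (b - a))
    (hτρ : ∀ a b, τ a * ρ b = τ (a + b)) (hττ : ∀ a b, τ a * τ b = ρ (c₀ + b - a))
    (hρ : Function.Injective ρ) (hτ : Function.Injective τ) (hne : ∀ a b, ρ a ≠ τ b)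
    (hsurj : ∀ g, (∃ a, ρ a = g) ∨ (∃ a, τ a = g)) (h : TripleProductProperty S T U) {b₁ b₃ t : A} (ht : t ≠ 0)
    (hT₀ : (univ.filter fun a : A => ρ a ∈ T) = {b₁, b₁ + t})
    (hT₁ : (univ.filter fun a : A => τ a ∈ T) = {b₃, b₃ + t})
    (hS : (univ.filter fun a : A => ρ a ∈ S).card = (univ.filter fun a : A => τ a ∈ S).card)
    (hU : (univ.filter fun a : A => ρ a ∈ U).card = (univ.filter fun a : A => τ a ∈ U).card)
    (hV : 3 * (S.card * T.card * U.card) + 8 = 8 * Fintype.card A) :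
    ∃ x₀ : A, ∀ y : A, y - x₀ ∈ AddSubgroup.zmultiples t := by
  have hbt : b₁ ≠ b₁ + t := fun e => ht (by
    have := e; rw [eq_comm, ← sub_eq_zero] at this; simpa using this)
  have hbt' : b₃ ≠ b₃ + t := fun e => ht (by
    have := e; rw [eq_comm, ← sub_eq_zero] at this; simpa using this)
  have cS := card_eq_parts' hρ hτ hne hsurj S
  have cT := card_eq_parts' hρ hτ hne hsurj T
  have cU := card_eq_parts' hρ hτ hne hsurj U
  rw [hT₀, hT₁, card_pair hbt, card_pair hbt'] at cT
  refine cyclic_of_aligned_pair_near_tiling hρρ hρτ hτρ hττ hρ hτ hne h ht hT₀ hT₁ ?_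
  set s₀ := (univ.filter fun a : A => ρ a ∈ S).card
  set s₁ := (univ.filter fun a : A => τ a ∈ S).card
  set u₀ := (univ.filter fun a : A => ρ a ∈ U).card
  set u₁ := (univ.filter fun a : A => τ a ∈ U).card
  have hprod : S.card * T.card * U.card = 16 * (s₀ * u₀) := by
    rw [cS, cT, cU, ← hS, ← hU]; ring
  rw [hprod] at hV
  have e1 : s₁ * u₀ = s₀ * u₀ := by rw [hS]
  have e2 : s₀ * u₁ = s₀ * u₀ := by rw [hU]
  rw [e1, e2]
  omega

end DihedralLike

end Summit.MatrixMultiplication.OmegaCensus
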